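import Literature.NumberTheory.QuadraticForms.LandherrHermitianDiagonalForms
import Mathlib.LinearAlgebra.Matrix.Transvection
import HarnessLib

/-!
# Hermitian matrices over a CM field are congruent to diagonal matrices

Topic `NumberTheory/QuadraticForms`; companion to `LandherrHermitianDiagonalForms.lean` /
`LandherrHermitianRankN.lean` (Landherr's theorem for DIAGONAL hermitian forms), removing the word
"diagonal". Let `L` be a CM field with complex conjugation `σ`, `ᵗσA = Landherr.conjTranspose L A`.

* `Landherr.splitEquiv i₀ : {i // i ≠ i₀} ⊕ Fin 1 ≃ ι` — index bookkeeping for the inductions;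
* `Landherr.conjTranspose_*` — the remaining `σ`-sesquilinear algebra (`add/neg/sub/smul/transvection`,
  involutivity, congruents of hermitian matrices are hermitian);
* `Landherr.exists_congr_apply_ne_zero` — after a congruence some diagonal entry is non-zero (if all
  `H i i = 0`, a transvection with column `eᵢ + (H i j)⁻¹ eⱼ` produces the entry `Tr_{L/L⁺}(1) = 2`);
* `Landherr.schur_step` — one symmetric elimination `ᵗσP · [[A, B], [C, c]] · P = [[A − c⁻¹BC, 0], [0, c]]`;
* `Landherr.exists_congr_diagonal` — every non-degenerate `σ`-hermitian matrix `H` (`ᵗσH = H`,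
  `det H ≠ 0`) is congruent over `L` to `diag d` with `d` `σ`-fixed and non-zero (symmetric Gauss
  elimination, induction on the size).

Provenance: `pub-hodgecm` package file `Proofs/LandherrMatrix.lean` §A (gen 7), ported to Mathlib vocabulary.

## References

* W. Landherr, Abh. Math. Sem. Univ. Hamburg 11 (1936) 245–248 [Landherr1936HermitianForms].
* W. Scharlau, *Quadratic and Hermitian Forms*, Grundlehren 270 (1985), Ch. 7 §6 and Ch. 10
  [Scharlau1985HermitianForms].
-/

noncomputable section

open NumberField
open scoped Matrix ComplexConjugate

namespace Literature.NumberTheory.QuadraticForms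

namespace Landherr

variable (L : Type) [Field L] [NumberField L] [IsCMField L]

/-! ## Splitting off one index -/

section Split

/-- `{i // i ≠ i₀} ⊕ Fin 1 ≃ ι`, the extra point going to `i₀`. [folklore] -/
def splitEquiv {ι : Type} [DecidableEq ι] (i₀ : ι) : {i // i ≠ i₀} ⊕ Fin 1 ≃ ι where
  toFun := Sum.elim Subtype.val (fun _ => i₀)
  invFun i := if h : i = i₀ then Sum.inr 0 else Sum.inl ⟨i, h⟩
  left_inv x := by
    rcases x with ⟨i, hi⟩ | j
    · simp [hi]
    · have := Subsingleton.elim j 0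
      subst this
      simp
  right_inv i := by
    by_cases h : i = i₀
    · simp [h]
    · simp [h]

/-- `splitEquiv` on the left summand. [folklore] -/
@[simp] theorem splitEquiv_inl {ι : Type} [DecidableEq ι] (i₀ : ι) (k : {i // i ≠ i₀}) :
    splitEquiv i₀ (Sum.inl k) = k.1 := rfl

/-- `splitEquiv` on the extra point. [folklore] -/
@[simp] theorem splitEquiv_inr {ι : Type} [DecidableEq ι] (i₀ : ι) (j : Fin 1) :
    splitEquiv i₀ (Sum.inr j) = i₀ := rfl

/-- `#{i // i ≠ i₀} = #ι - 1`. [folklore] -/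
theorem card_ne (ι : Type) [Fintype ι] [DecidableEq ι] (i₀ : ι) :
    Fintype.card {i // i ≠ i₀} = Fintype.card ι - 1 := by
  rw [Fintype.card_subtype_compl (fun i => i = i₀), Fintype.card_subtype_eq]

end Split

/-! ## §A. Symmetric Gauss elimination: congruence to a diagonal matrix over `L` -/

section Elim

variable {ι κ : Type}

/-- `ᵗσ(ᵗσA) = A`. [folklore] -/
theorem conjTranspose_conjTranspose (A : Matrix ι κ L) : conjTranspose L (conjTranspose L A) = A := by
  ext i j
  simp [conjTranspose_apply]

/-- `ᵗσ` is additive. [folklore] -/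
theorem conjTranspose_add (A B : Matrix ι κ L) : conjTranspose L (A + B) = conjTranspose L A + conjTranspose L B := by
  ext i j
  simp [conjTranspose_apply]

/-- `ᵗσ(−A) = −ᵗσA`. [folklore] -/
theorem conjTranspose_neg (A : Matrix ι κ L) : conjTranspose L (-A) = -conjTranspose L A := by
  ext i j
  simp [conjTranspose_apply]

/-- `ᵗσ(A − B) = ᵗσA − ᵗσB`. [folklore] -/
theorem conjTranspose_sub (A B : Matrix ι κ L) : conjTranspose L (A - B) = conjTranspose L A - conjTranspose L B := by
  ext i j
  simp [conjTranspose_apply]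

/-- `ᵗσ(c • A) = σ c • ᵗσA`. [folklore] -/
theorem conjTranspose_smul (c : L) (A : Matrix ι κ L) : conjTranspose L (c • A) = IsCMField.complexConj L c • conjTranspose L A := by
  ext i j
  simp [conjTranspose_apply]

/-- Conjugate transpose of a transvection. [folklore] -/
theorem conjTranspose_transvection [DecidableEq ι] (i j : ι) (c : L) :
    conjTranspose L (Matrix.transvection i j c) = Matrix.transvection j i (IsCMField.complexConj L c) := by
  ext a b
  simp only [conjTranspose_apply, Matrix.transvection, Matrix.add_apply, Matrix.one_apply, Matrix.single_apply, map_add,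
    apply_ite (IsCMField.complexConj L), map_one, map_zero]
  simp only [eq_comm, and_comm]

/-- A congruent of a hermitian matrix is hermitian. [folklore] -/
theorem conjTranspose_congr [Fintype ι] {G H : Matrix ι ι L} (hH : conjTranspose L H = H) : conjTranspose L (conjTranspose L G * H * G) = conjTranspose L G * H * G := by
  rw [conjTranspose_mul, conjTranspose_mul, conjTranspose_conjTranspose, hH, Matrix.mul_assoc]

/-- A congruence by an invertible matrix preserves `det ≠ 0`. [folklore] -/
theorem det_congr_ne_zero [Fintype ι] [DecidableEq ι] {G H : Matrix ι ι L} (hG : IsUnit G.det) (hH : H.det ≠ 0) :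
    (conjTranspose L G * H * G).det ≠ 0 := by
  rw [Matrix.det_mul, Matrix.det_mul, det_conjTranspose]
  exact mul_ne_zero (mul_ne_zero ((map_ne_zero _).mpr hG.ne_zero) hH) hG.ne_zero

/-- Entries of a `σ`-hermitian matrix: `σ (H i j) = H j i`. [folklore] -/
theorem hermitian_apply {H : Matrix ι ι L} (hH : conjTranspose L H = H) (i j : ι) : IsCMField.complexConj L (H i j) = H j i := by
  have h := congrFun (congrFun hH j) i
  rwa [conjTranspose_apply] at h

/-- Step 1: after a congruence some diagonal entry is non-zero.  If all `H i i = 0`, pick `H i j ≠ 0` and use the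
transvection with column `eᵢ + (H i j)⁻¹ eⱼ`: the new `(i,i)` entry is `Tr(1) = 2`. [folklore] -/
theorem exists_congr_apply_ne_zero [Fintype ι] [DecidableEq ι] [Nonempty ι] (H : Matrix ι ι L) (hH : conjTranspose L H = H) (hdet : H.det ≠ 0) :
    ∃ G : Matrix ι ι L, IsUnit G.det ∧ ∃ i₀, (conjTranspose L G * H * G) i₀ i₀ ≠ 0 := by
  by_cases hdiag : ∃ i, H i i ≠ 0
  · obtain ⟨i, hi⟩ := hdiag
    exact ⟨1, by simp, i, by rwa [conjTranspose_one, Matrix.one_mul, Matrix.mul_one]⟩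
  · simp only [not_exists, not_not] at hdiag
    have hH0 : H ≠ 0 := by
      rintro rfl
      exact hdet Matrix.det_zero
    obtain ⟨i, j, hij⟩ : ∃ i j, H i j ≠ 0 := by
      by_contra h
      simp only [not_exists, not_not] at h
      exact hH0 (Matrix.ext fun i j => h i j)
    have hne : i ≠ j := by
      rintro rfl
      exact hij (hdiag i)
    refine ⟨Matrix.transvection j i (H i j)⁻¹, ?_, i, ?_⟩
    · rw [Matrix.det_transvection_of_ne _ _ hne.symm]
      exact isUnit_one
    · rw [conjTranspose_transvection, Matrix.mul_transvection_apply_same, Matrix.transvection_mul_apply_same,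
        Matrix.transvection_mul_apply_same, hdiag i, hdiag j, ← hermitian_apply L hH i j, mul_zero, add_zero,
        zero_add, ← map_mul, inv_mul_cancel₀ hij, map_one]
      norm_num

/-- Transport of a congruence along a bijection of the index set. [folklore] -/
theorem congr_submatrix [Fintype ι] [Fintype κ] (e : κ ≃ ι) (K G D : Matrix κ κ L) (h : conjTranspose L G * K * G = D) :
    conjTranspose L (G.submatrix e.symm e.symm) * K.submatrix e.symm e.symm * G.submatrix e.symm e.symm =
      D.submatrix e.symm e.symm := by
  rw [conjTranspose_submatrix, Matrix.submatrix_mul_equiv, Matrix.submatrix_mul_equiv, h]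

omit [Field L] [NumberField L] [IsCMField L] in
/-- Reindexing forth and back. [folklore] -/
theorem submatrix_submatrix_symm (e : κ ≃ ι) (H : Matrix ι ι L) :
    (H.submatrix e e).submatrix e.symm e.symm = H := by
  ext i j
  simp

/-- Step 2 (one symmetric elimination): the block identity
`ᵗσP · [[A, B], [C, c]] · P = [[A − c⁻¹ BC, 0], [0, c]]` for `P = [[1, 0], [−c⁻¹ C, 1]]`, `ᵗσC = B`, `σc = c ≠ 0`. [folklore] -/
theorem schur_step [Fintype κ] [DecidableEq κ] (A : Matrix κ κ L) (B : Matrix κ (Fin 1) L) (C : Matrix (Fin 1) κ L) {c : L} (hc : c ≠ 0)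
    (hσc : IsCMField.complexConj L c = c) (hCB : conjTranspose L C = B) :
    conjTranspose L (Matrix.fromBlocks 1 0 (-(c⁻¹ • C)) (1 : Matrix (Fin 1) (Fin 1) L)) *
        Matrix.fromBlocks A B C (c • (1 : Matrix (Fin 1) (Fin 1) L)) *
        Matrix.fromBlocks 1 0 (-(c⁻¹ • C)) (1 : Matrix (Fin 1) (Fin 1) L) =
      Matrix.fromBlocks (A - c⁻¹ • (B * C)) 0 0 (c • (1 : Matrix (Fin 1) (Fin 1) L)) := by
  rw [conjTranspose_fromBlocks, conjTranspose_one, conjTranspose_one, conjTranspose_zero, conjTranspose_neg, conjTranspose_smul, hCB, map_inv₀, hσc]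
  simp only [Matrix.fromBlocks_multiply, Matrix.one_mul, Matrix.mul_one, Matrix.zero_mul, Matrix.mul_zero,
    add_zero, zero_add, Matrix.neg_mul, Matrix.mul_neg, Matrix.smul_mul, Matrix.mul_smul, smul_neg, smul_smul,
    inv_mul_cancel₀ hc, mul_inv_cancel₀ hc, one_smul, add_neg_cancel, smul_zero, neg_zero, sub_eq_add_neg]

/-- Blocks of a hermitian matrix over `κ ⊕ Fin 1`. [folklore] -/
theorem blocks_of_hermitian {K : Matrix (κ ⊕ Fin 1) (κ ⊕ Fin 1) L} (hK : conjTranspose L K = K) :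
    conjTranspose L K.toBlocks₁₁ = K.toBlocks₁₁ ∧ conjTranspose L K.toBlocks₂₁ = K.toBlocks₁₂ ∧ conjTranspose L K.toBlocks₁₂ = K.toBlocks₂₁ ∧
      conjTranspose L K.toBlocks₂₂ = K.toBlocks₂₂ := by
  have h := hK
  rw [← Matrix.fromBlocks_toBlocks K, conjTranspose_fromBlocks, Matrix.fromBlocks_inj] at h
  rw [← Matrix.fromBlocks_toBlocks K]
  simp only [Matrix.toBlocks_fromBlocks₁₁, Matrix.toBlocks_fromBlocks₁₂, Matrix.toBlocks_fromBlocks₂₁,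
    Matrix.toBlocks_fromBlocks₂₂]
  exact ⟨h.1, h.2.1, h.2.2.1, h.2.2.2⟩

omit [NumberField L] [IsCMField L] in
/-- The `1 × 1` corner block is a scalar. [folklore] -/
theorem toBlocks₂₂_eq_smul_one (K : Matrix (κ ⊕ Fin 1) (κ ⊕ Fin 1) L) :
    K.toBlocks₂₂ = K (Sum.inr 0) (Sum.inr 0) • (1 : Matrix (Fin 1) (Fin 1) L) := by
  ext i j
  have hi := Subsingleton.elim i 0
  have hj := Subsingleton.elim j 0
  subst hi hj
  simp [Matrix.toBlocks₂₂]

/-- **Congruence to a diagonal matrix** (induction on the size). [cite: Landherr1936HermitianForms] -/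
theorem exists_congr_diagonal_aux : ∀ (n : ℕ) (ι : Type) [Fintype ι] [DecidableEq ι], Fintype.card ι = n →
    ∀ H : Matrix ι ι L, conjTranspose L H = H → H.det ≠ 0 →
    ∃ G : Matrix ι ι L, IsUnit G.det ∧ ∃ d : ι → L, conjTranspose L G * H * G = Matrix.diagonal d := by
  intro n
  induction n with
  | zero =>
    intro ι _ _ hcard H _ _
    haveI : IsEmpty ι := Fintype.card_eq_zero_iff.mp hcard
    exact ⟨1, by simp, fun _ => 0, Matrix.ext fun i _ => (IsEmpty.false i).elim⟩
  | succ m ih =>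
    intro ι _ _ hcard H hH hdet
    haveI : Nonempty ι := Fintype.card_pos_iff.mp (by omega)
    -- Step 1
    obtain ⟨G₁, hG₁, i₀, hi₀⟩ := exists_congr_apply_ne_zero L H hH hdet
    set H₁ := conjTranspose L G₁ * H * G₁ with hH₁def
    have hH₁ : conjTranspose L H₁ = H₁ := conjTranspose_congr L hH
    have hdet₁ : H₁.det ≠ 0 := det_congr_ne_zero L hG₁ hdet
    -- Step 2: reindex along `{i // i ≠ i₀} ⊕ Fin 1 ≃ ι` and eliminate
    set e := splitEquiv i₀ with he
    set K := H₁.submatrix e e with hKdef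
    have hK : conjTranspose L K = K := by rw [hKdef, conjTranspose_submatrix, hH₁]
    have hdetK : K.det ≠ 0 := by rwa [hKdef, Matrix.det_submatrix_equiv_self]
    set c := H₁ i₀ i₀ with hcdef
    have hc : c ≠ 0 := hi₀
    have hσc : IsCMField.complexConj L c = c := hermitian_apply L hH₁ i₀ i₀
    obtain ⟨hA, hCB, hBC, -⟩ := blocks_of_hermitian L hK
    have hD : K.toBlocks₂₂ = c • (1 : Matrix (Fin 1) (Fin 1) L) := by
      rw [toBlocks₂₂_eq_smul_one]
      simp [hKdef, he, hcdef]
    set A := K.toBlocks₁₁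
    set B := K.toBlocks₁₂
    set C := K.toBlocks₂₁
    have hKblocks : K = Matrix.fromBlocks A B C (c • (1 : Matrix (Fin 1) (Fin 1) L)) := by
      rw [← hD]; exact (Matrix.fromBlocks_toBlocks K).symm
    set P : Matrix ({i // i ≠ i₀} ⊕ Fin 1) ({i // i ≠ i₀} ⊕ Fin 1) L :=
      Matrix.fromBlocks 1 0 (-(c⁻¹ • C)) (1 : Matrix (Fin 1) (Fin 1) L) with hPdef
    have hPdet : P.det = 1 := by
      rw [hPdef, Matrix.det_fromBlocks_zero₁₂, Matrix.det_one, Matrix.det_one, one_mul]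
    have hstep : conjTranspose L P * K * P = Matrix.fromBlocks (A - c⁻¹ • (B * C)) 0 0 (c • (1 : Matrix (Fin 1) (Fin 1) L)) := by
      rw [hKblocks]
      exact schur_step L A B C hc hσc hCB
    -- the Schur complement is hermitian and non-degenerate
    set A' := A - c⁻¹ • (B * C) with hA'def
    have hA' : conjTranspose L A' = A' := by
      rw [hA'def, conjTranspose_sub, conjTranspose_smul, conjTranspose_mul, hA, hCB, hBC, map_inv₀, hσc]
    have hdetA' : A'.det ≠ 0 := by
      have h := congrArg Matrix.det hstep
      rw [Matrix.det_mul, Matrix.det_mul, det_conjTranspose, hPdet, map_one, one_mul, mul_one,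
        Matrix.det_fromBlocks_zero₂₁, Matrix.det_smul, Matrix.det_one, mul_one, Fintype.card_fin, pow_one] at h
      intro h0
      rw [h0, zero_mul] at h
      exact hdetK h
    -- induction hypothesis on the complement
    have hcardκ : Fintype.card {i // i ≠ i₀} = m := by rw [card_ne]; omega
    obtain ⟨G₃, hG₃, d₃, e₃⟩ := ih {i // i ≠ i₀} hcardκ A' hA' hdetA'
    set Q : Matrix ({i // i ≠ i₀} ⊕ Fin 1) ({i // i ≠ i₀} ⊕ Fin 1) L :=
      Matrix.fromBlocks G₃ 0 0 (1 : Matrix (Fin 1) (Fin 1) L) with hQdef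
    have hQdet : IsUnit Q.det := by
      rw [hQdef, Matrix.det_fromBlocks_zero₂₁, Matrix.det_one, mul_one]; exact hG₃
    have hKdiag : conjTranspose L (P * Q) * K * (P * Q) = Matrix.diagonal (Sum.elim d₃ fun _ => c) := by
      calc conjTranspose L (P * Q) * K * (P * Q) = conjTranspose L Q * (conjTranspose L P * K * P) * Q := by
            rw [conjTranspose_mul]; simp only [Matrix.mul_assoc]
        _ = Matrix.diagonal (Sum.elim d₃ fun _ => c) := by
            rw [hstep, hQdef, conjTranspose_fromBlocks, conjTranspose_zero, conjTranspose_zero, conjTranspose_one, Matrix.fromBlocks_multiply,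
              Matrix.fromBlocks_multiply, ← Matrix.fromBlocks_diagonal, Matrix.smul_one_eq_diagonal]
            simp [e₃]
    -- transport back to `ι`
    refine ⟨G₁ * (P * Q).submatrix e.symm e.symm, ?_, (Sum.elim d₃ fun _ => c) ∘ e.symm, ?_⟩
    · rw [Matrix.det_mul, Matrix.det_submatrix_equiv_self, Matrix.det_mul, hPdet, one_mul]
      exact hG₁.mul hQdet
    · have h := congr_submatrix L e K (P * Q) _ hKdiag
      rw [hKdef, submatrix_submatrix_symm, Matrix.submatrix_diagonal_equiv, hH₁def] at h
      rw [conjTranspose_mul, ← h]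
      simp only [Matrix.mul_assoc]

/-- **Every non-degenerate `σ`-hermitian matrix over a CM field is congruent over `L` to a diagonal matrix** with
`σ`-fixed non-zero entries. [cite: Landherr1936HermitianForms] -/
theorem exists_congr_diagonal [Fintype ι] [DecidableEq ι] (H : Matrix ι ι L) (hH : conjTranspose L H = H) (hdet : H.det ≠ 0) :
    ∃ G : Matrix ι ι L, IsUnit G.det ∧ ∃ d : ι → L,
      (∀ i, IsCMField.complexConj L (d i) = d i) ∧ (∀ i, d i ≠ 0) ∧ conjTranspose L G * H * G = Matrix.diagonal d := by
  obtain ⟨G, hG, d, e⟩ := exists_congr_diagonal_aux L (Fintype.card ι) ι rfl H hH hdet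
  refine ⟨G, hG, d, fun i => ?_, fun i => ?_, e⟩
  · have h := conjTranspose_congr L (G := G) hH
    rw [e] at h
    have hi := congrFun (congrFun h i) i
    simpa [conjTranspose_apply] using hi
  · have h := det_congr_ne_zero L hG hdet
    rw [e, Matrix.det_diagonal] at h
    exact (Finset.prod_ne_zero_iff.mp h) i (Finset.mem_univ i)

end Elim

end Landherr

end Literature.NumberTheory.QuadraticForms

end
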